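import Literature.NumberTheory.EllipticCurves.CasselsTateLemma615
import HarnessLib

/-!
# Milne I Lemma 6.17 for the Cassels–Tate pairing at level `m` (first case): orthogonal to `Ш[m]` ⇒ in `mШ`

Topic `NumberTheory/EllipticCurves`; namespace `Literature.NumberTheory.EllipticCurves` (as
`CasselsTateFirstCase.lean`, `CasselsTateLemma615.lean`). Theorems only: **no named fact and no
definition is introduced** (D-0026). The arithmetic inputs of Milne's proof enter as explicit, canonical
hypotheses on the chosen data, exactly as in `CasselsTateFirstCase.lean`: `hiso` (isotropy of the local
Kummer conditions at level `m²`, discharged in the tree by `KummerImageIsotropyProofs`), `hPT` (the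
reciprocity predicate `LocalInvariants.SumLocalTermEqZero` on the family `inv`), and `h615` — the
conclusion of Lemma 6.15 (`CasselsTateLemma615.forall_mem_selmerGroup_sumPairing_eq_zero_iff`, forward
direction) for all finite sets of places containing a fixed finite set `S₀`.

Setting (Milne, *ADT*, I §6, proof of Thm. 6.13(a), in the conventions of `CasselsTateFirstCase.lean`:
level `m`, auxiliary level `m²`, Weil pairing `e` on `E[m²]`, family `inv : LocalInvariants K (m * m)`,
first-case pairing `ctFirstCaseFun W m e … inv : H¹(K, E) × H¹(K, E) → ℤ/m²`).

**Lemma 6.17** (`exists_mem_sha_smul_eq_of_forall_ctFirstCaseFun_eq_zero`).  Let `a ∈ Ш(E/K)[m]` be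
divisible by `m` in `H¹(K, E)`, `a = m a₁` (Milne's `a ∈ Ш'(K, A)`: this is exactly the FIRST CASE of
the definition of the pairing, `δ b = 0`).  If `⟨a, a'⟩ = 0` for all `a' ∈ Ш(E/K)[m]`, then `a ∈ m Ш(E/K)`.

Proof (Milne, p. 87–88, followed line by line).  `m² a₁ = m a = 0`, so `a₁` is the image of some
`b₁ ∈ H¹(K, E[m²])` (Kummer sequence, tree `range_torsionH1ToH1_eq_torsionBy_holds`); `b = [m]_* b₁` is a
Selmer lift of `a`.  Choose local Kummer lifts `β_v ∈ 𝓛_v^{(m²)}` of `loc_v b` and `c_v ∈ H¹(K_v, E[m])`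
with `ι_* c_v = loc_v b₁ - β_v`.  Let `S ⊇ S₀` be a finite set of places containing the exceptional set of
`b₁`.  For every Selmer `b'` (lifting `a' ∈ Ш[m]`), by the definition of the first case and
`(ι_* c_v) ∪_{m²} β'_v = c_v ∪_desc loc_v b'` (`weilLocalCup_map_inclKD`),
`∑_{v∈S} inv_v(c_v ∪_desc loc_v b') = ⟨a, a'⟩ = 0`.  By Lemma 6.15 there is `b₀ ∈ H¹(G_S, E[m])` with
`c_v - loc_v b₀ ∈ 𝓛_v^{(m)}` for `v ∈ S`.  Then `b₁ - ι_* b₀ ∈ Sel^{(m²)}(E/K)`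
(at `v ∈ S`: `loc_v(b₁ - ι_* b₀) = ι_*(c_v - loc_v b₀) + β_v`; at `v ∉ S`: both terms lie in `𝓛_v^{(m²)}`),
so its image `a₁ - a₀'` in `H¹(K, E)` lies in `Ш` (`a₀'` the image of `b₀`, killed by `m`), and
`m (a₁ - a₀') = a`.

Also recorded: the easy converse (tree `ctFirstCaseFun_eq_zero_of_eq_smul`) packaged as the iff
`exists_mem_sha_smul_eq_iff_forall_ctFirstCaseFun_eq_zero` — Milne's Lemma 6.17 verbatim for `A = E`.

Motivation: provefact `WeierstrassCurve.exists_casselsTate_pairing` (kernel direction of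
`IsLevelPairing`, Milne I Thm. 6.13(a)).

## References

* [MilneADT2006] J. S. Milne, *Arithmetic Duality Theorems*, 2nd ed. (2006), Ch. I §6: Prop. 6.9 (first
  case of the definition), Lemma 6.15, Lemma 6.17 and the proof of Thm. 6.13(a), pp. 87–88.
-/

noncomputable section

open scoped Classical

universe u

namespace Literature.NumberTheory.EllipticCurves

open CategoryTheory _root_.WeierstrassCurve Field Function NumberField IsDedekindDomain
open Literature.NumberTheory.GaloisRepresentations Literature.NumberTheory.GaloisCohomology
open Literature.NumberTheory.GaloisRepresentations.DiscreteGaloisModule (mu MuCarrier pairing)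
open scoped ContRepresentation

-- Cup products need `LocallyCompactSpace Γ`; as in the tree's cup-product files, the compactness of
-- absolute Galois groups is a local instance only.
attribute [local instance] absoluteGaloisGroup_compactSpace

variable {K : Type u} [Field K] [NumberField K] (W : WeierstrassCurve K) (m : ℕ) [NeZero m]

/-! ## Change of level on the local Kummer conditions -/

/-- **`ι_*` maps `𝓛_E^{(m)}` into `𝓛_E^{(m²)}`** (`ι : E[m] ↪ E[m²]`): `ι_* κ_{E,m}(Q) = κ_{E,m²}(Q)` for
`Q ∈ E(K̄_E)` with `m Q ∈ E(E)` (tree `map_torsionInclusion_localKummerClass`).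
[cite: MilneADT2006, Ch. I §6, proof of Prop. 6.9] -/
theorem map_inclKD_mem_kummerLocalConditionAt [W.IsElliptic] (E : Type u) [Field E] [Algebra K E]
    {c : galoisCohomology (GaloisRep.restrictField E (W.torsionGaloisModule (m : ℤ))) 1}
    (hc : c ∈ W.kummerLocalConditionAt (m : ℤ) E) :
    galoisCohomology.map ((inclKD W m m).restrictField E) 1 c ∈
      W.kummerLocalConditionAt ((m * m : ℕ) : ℤ) E := by
  have hm : (m : ℤ) ≠ 0 := Int.natCast_ne_zero.mpr (NeZero.ne m)
  have hmm : ((m * m : ℕ) : ℤ) ≠ 0 := Int.natCast_ne_zero.mpr (NeZero.ne (m * m))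
  obtain ⟨Q, hQ, rfl⟩ := W.exists_eq_localKummerClass_of_mem (m : ℤ) hm hc
  have hQ' : ((m * m : ℕ) : ℤ) • Q ∈ MulAction.fixedPoints (absoluteGaloisGroup E) (localPoints W E) := by
    intro σ
    rw [Nat.cast_mul, mul_zsmul, smul_zsmul_localPoints, hQ σ]
  have key : galoisCohomology.map ((inclKD W m m).restrictField E) 1 (W.localKummerClass (m : ℤ) hm Q hQ) =
      W.localKummerClass ((m * m : ℕ) : ℤ) hmm Q hQ' :=
    W.map_torsionInclusion_localKummerClass _ hm hmm Q hQ hQ'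
  rw [key]
  exact W.localKummerClass_mem_kummerLocalConditionAt _ hmm Q hQ'

/-! ## Lemma 6.17 -/

section Pairing

variable (e : geomTorsion W ((m * m : ℕ) : ℤ) → geomTorsion W ((m * m : ℕ) : ℤ) → AlgebraicClosure K)
  (hμ : ∀ S T, e S T ^ (m * m) = 1)
  (hadd₁ : ∀ S₁ S₂ T, e (S₁ + S₂) T = e S₁ T * e S₂ T)
  (hadd₂ : ∀ S T₁ T₂, e S (T₁ + T₂) = e S T₁ * e S T₂)
  (hgal : ∀ (σ : absoluteGaloisGroup K) (S T : geomTorsion W ((m * m : ℕ) : ℤ)),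
    σ • e S T = e (σ • S) (σ • T))
variable (inv : LocalInvariants K (m * m))

variable {W m e hμ hadd₁ hadd₂ hgal}
variable (hiso : ∀ (v : Place K)
    ⦃x y : galoisCohomology (GaloisRep.restrictField (Place.Completion v)
      (W.torsionGaloisModule ((m * m : ℕ) : ℤ))) 1⦄,
    x ∈ W.kummerLocalConditionAt ((m * m : ℕ) : ℤ) (Place.Completion v) →
      y ∈ W.kummerLocalConditionAt ((m * m : ℕ) : ℤ) (Place.Completion v) →
        weilLocalCup W m (Place.Completion v) e hμ hadd₁ hadd₂ hgal x y = 0)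
-- as in `CasselsTateFirstCase.lean`: `hPT` is the reciprocity PREDICATE on `inv`, not a named fact.
variable (hPT : inv.SumLocalTermEqZero)
include hiso hPT

/-- **Milne I Lemma 6.17, hard direction** (level `m`, first case).  Hypotheses: `hiso`, `hPT` as in
`CasselsTateFirstCase.lean`; `h615`: the conclusion of Lemma 6.15 (forward direction of
`forall_mem_selmerGroup_sumPairing_eq_zero_iff`) for every finite set of places containing `S₀` — an
`x ∈ ∏_{v∈S} H¹(K_v, E[m])` annihilating `loc_S(Sel^{(m)})` under `∑_{v∈S} inv_v(· ∪_desc ·)` is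
`loc_S` of a class of `H¹(G_S, E[m])` up to local Kummer classes.  Conclusion: an `a ∈ Ш(E/K)` killed by
`m` and divisible by `m` in `H¹(K, E)` (`a = m a₁`) that is orthogonal to `Ш(E/K)[m]` under the first-case
pairing `ctFirstCaseFun` is divisible by `m` in `Ш(E/K)`.
[cite: MilneADT2006, Ch. I §6, Lemma 6.17 (proof, pp. 87–88)] -/
theorem exists_mem_sha_smul_eq_of_forall_ctFirstCaseFun_eq_zero [W.IsElliptic] (S₀ : Finset (Place K))
    (h615 : ∀ S : Finset (Place K), S₀ ⊆ S → ∀ x : LocalClasses W m S,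
      (∀ b' ∈ selmerGroup W (m : ℤ), sumPairing W m e hμ hadd₁ hadd₂ hgal inv S x (locS W m S b') = 0) →
        ∃ b₀ ∈ kummerOutside W m S, ∀ v : S,
          x v - locS W m S b₀ v ∈ W.kummerLocalConditionAt (m : ℤ) (Place.Completion (v : Place K)))
    {a a₁ : W.galH1} (ha : a ∈ W.sha) (hma : (m : ℤ) • a = 0) (ha₁ : (m : ℤ) • a₁ = a)
    (horth : ∀ a' ∈ W.sha, (m : ℤ) • a' = 0 → ctFirstCaseFun W m e hμ hadd₁ hadd₂ hgal inv a a' = 0) :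
    ∃ a₀ ∈ W.sha, (m : ℤ) • a₀ = a := by
  have hmm : ((m * m : ℕ) : ℤ) ≠ 0 := Int.natCast_ne_zero.mpr (NeZero.ne (m * m))
  -- `m² a₁ = 0`, so `a₁` lifts to `b₁ ∈ H¹(K, E[m²])` (Kummer sequence)
  have hm2a₁ : ((m * m : ℕ) : ℤ) • a₁ = 0 := by rw [Nat.cast_mul, mul_zsmul, ha₁, hma]
  have ha₁r : a₁ ∈ (torsionH1ToH1 W ((m * m : ℕ) : ℤ)).range := by
    rw [range_torsionH1ToH1_eq_torsionBy_holds W hmm]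
    change ((m * m : ℕ) : ℤ) • a₁ = 0
    exact hm2a₁
  obtain ⟨b₁, hb₁⟩ : ∃ b₁ : galoisCohomology (W.torsionGaloisModule ((m * m : ℕ) : ℤ)) 1,
    torsionH1ToH1 W ((m * m : ℕ) : ℤ) b₁ = a₁ := ha₁r
  -- `b = [m]_* b₁` is a Selmer lift of `a`
  obtain ⟨b, hbdef⟩ : ∃ b : galoisCohomology (W.torsionGaloisModule (m : ℤ)) 1,
    galoisCohomology.map (mulK W m m) 1 b₁ = b := ⟨_, rfl⟩
  have hTb : torsionH1ToH1 W (m : ℤ) b = a := by rw [← hbdef, torsionH1ToH1_map_mulK, hb₁, ha₁]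
  have hbSel : b ∈ selmerGroup W (m : ℤ) := by
    rw [selmerGroup_eq_comap_sha]
    change torsionH1ToH1 W (m : ℤ) b ∈ W.sha
    rw [hTb]
    exact ha
  have hloc : ∀ v : Place K, galoisCohomology.res (W.torsionGaloisModule (m : ℤ)) (Place.Completion v) 1 b ∈
      W.kummerLocalConditionAt (m : ℤ) (Place.Completion v) :=
    (W.mem_selmerGroup_iff_forall_localization_mem (m : ℤ) b).mp hbSel
  -- local Kummer lifts `β_v` of `loc_v b` and the classes `c_v`, `ι_* c_v = loc_v b₁ - β_v`
  choose β hβmem hβmap using fun v => FirstCaseData.exists_local_lift (W := W) (m := m) (Place.Completion v) (hloc v)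
  have hy : ∀ v : Place K, galoisCohomology.map ((mulK W m m).restrictField (Place.Completion v)) 1
      (galoisCohomology.res (W.torsionGaloisModule ((m * m : ℕ) : ℤ)) (Place.Completion v) 1 b₁ - β v) = 0 :=
    fun v => by rw [map_sub, ← galoisCohomology.res_map_one, hbdef, hβmap v, sub_self]
  choose c hc using fun v => exists_map_inclKD_eq_of_map_mulK_eq_zero (W := W) (m := m) (Place.Completion v) (hy v)
  -- the reference data (with `b' := b`) and the finite set `S`
  let D₀ : FirstCaseData W m :=
    { b := b, b_mem := hbSel, b₁ := b₁, map_b₁ := hbdef, β := β, β_mem := hβmem, map_β := hβmap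
      b' := b, b'_mem := hbSel, β' := β, β'_mem := hβmem, map_β' := hβmap }
  let S : Finset (Place K) := S₀ ∪ D₀.badSet
  have hbadS : D₀.badSet ⊆ S := Finset.subset_union_right
  -- `x = (c_v)_{v ∈ S}` annihilates the localisations of all Selmer classes: `∑_v inv_v(c_v ∪ b'_v) = ⟨a, a'⟩ = 0`
  have hx : ∀ b' ∈ selmerGroup W (m : ℤ),
      sumPairing W m e hμ hadd₁ hadd₂ hgal inv S (fun v => c v) (locS W m S b') = 0 := by
    intro b' hb'
    have hloc' : ∀ v : Place K, galoisCohomology.res (W.torsionGaloisModule (m : ℤ)) (Place.Completion v) 1 b' ∈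
        W.kummerLocalConditionAt (m : ℤ) (Place.Completion v) :=
      (W.mem_selmerGroup_iff_forall_localization_mem (m : ℤ) b').mp hb'
    choose β' hβ'mem hβ'map using fun v =>
      FirstCaseData.exists_local_lift (W := W) (m := m) (Place.Completion v) (hloc' v)
    let D : FirstCaseData W m :=
      { b := b, b_mem := hbSel, b₁ := b₁, map_b₁ := hbdef, β := β, β_mem := hβmem, map_β := hβmap
        b' := b', b'_mem := hb', β' := β', β'_mem := hβ'mem, map_β' := hβ'map }
    have hS : D.badSet ⊆ S := hbadS
    -- `a' = ` the image of `b'` lies in `Ш[m]`, so `⟨a, a'⟩ = 0`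
    have ha' : torsionH1ToH1 W (m : ℤ) b' ∈ W.sha := by
      have h := hb'
      rw [selmerGroup_eq_comap_sha] at h
      exact h
    have hma' : (m : ℤ) • torsionH1ToH1 W (m : ℤ) b' = 0 := torsionH1ToH1_mem_torsionBy W (m : ℤ) b'
    have hval : D.value e hμ hadd₁ hadd₂ hgal inv = 0 := by
      rw [← ctFirstCaseFun_eq inv hiso hPT D]
      change ctFirstCaseFun W m e hμ hadd₁ hadd₂ hgal inv (torsionH1ToH1 W (m : ℤ) b) (torsionH1ToH1 W (m : ℤ) b') = 0
      rw [hTb]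
      exact horth _ ha' hma'
    -- the local terms of `D` are `inv_v(c_v ∪_desc loc_v b')`
    have hlt : ∀ v : Place K, D.localTerm e hμ hadd₁ hadd₂ hgal inv v =
        descLocalPairing W m e hμ hadd₁ hadd₂ hgal inv v (c v)
          (galoisCohomology.res (W.torsionGaloisModule (m : ℤ)) (Place.Completion v) 1 b') := fun v => by
      change inv v (weilLocalCup W m (Place.Completion v) e hμ hadd₁ hadd₂ hgal
          (galoisCohomology.res (W.torsionGaloisModule ((m * m : ℕ) : ℤ)) (Place.Completion v) 1 b₁ - β v)
          (β' v)) = _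
      rw [← hc v, weilLocalCup_map_inclKD, hβ'map v, descLocalPairing_apply, descLocalCup_apply]
    rw [sumPairing_apply]
    simp only [locS_apply]
    rw [Finset.sum_coe_sort S (fun v => descLocalPairing W m e hμ hadd₁ hadd₂ hgal inv v (c v)
      (galoisCohomology.res (W.torsionGaloisModule (m : ℤ)) (Place.Completion v) 1 b'))]
    calc ∑ v ∈ S, descLocalPairing W m e hμ hadd₁ hadd₂ hgal inv v (c v)
          (galoisCohomology.res (W.torsionGaloisModule (m : ℤ)) (Place.Completion v) 1 b')
        = ∑ v ∈ S, D.localTerm e hμ hadd₁ hadd₂ hgal inv v := Finset.sum_congr rfl fun v _ => (hlt v).symm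
      _ = 0 := by rw [D.sum_localTerm_eq_value inv hiso hS, hval]
  -- Lemma 6.15: `c_v ≡ loc_v b₀ (mod 𝓛_v)` on `S` for some `b₀ ∈ H¹(G_S, E[m])`
  obtain ⟨b₀, hb₀, hb₀S⟩ := h615 S Finset.subset_union_left (fun v => c v) hx
  -- `b₁ - ι_* b₀` is a Selmer class at level `m²`
  have hsel : b₁ - galoisCohomology.map (inclKD W m m) 1 b₀ ∈ selmerGroup W ((m * m : ℕ) : ℤ) := by
    refine (W.mem_selmerGroup_iff_forall_localization_mem _ _).mpr fun v => ?_
    change galoisCohomology.res (W.torsionGaloisModule ((m * m : ℕ) : ℤ)) (Place.Completion v) 1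
        (b₁ - galoisCohomology.map (inclKD W m m) 1 b₀) ∈
      W.kummerLocalConditionAt ((m * m : ℕ) : ℤ) (Place.Completion v)
    rw [map_sub, galoisCohomology.res_map_one]
    by_cases hv : v ∈ S
    · have h1 : galoisCohomology.res (W.torsionGaloisModule ((m * m : ℕ) : ℤ)) (Place.Completion v) 1 b₁ -
          galoisCohomology.map ((inclKD W m m).restrictField (Place.Completion v)) 1
            (galoisCohomology.res (W.torsionGaloisModule (m : ℤ)) (Place.Completion v) 1 b₀) =
          galoisCohomology.map ((inclKD W m m).restrictField (Place.Completion v)) 1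
            (c v - galoisCohomology.res (W.torsionGaloisModule (m : ℤ)) (Place.Completion v) 1 b₀) + β v := by
        rw [map_sub, hc v]; abel
      rw [h1]
      exact add_mem (map_inclKD_mem_kummerLocalConditionAt W m (Place.Completion v) (hb₀S ⟨v, hv⟩)) (hβmem v)
    · exact sub_mem (D₀.res_b₁_mem_of_not_mem_badSet fun h => hv (hbadS h))
        (map_inclKD_mem_kummerLocalConditionAt W m (Place.Completion v)
          ((mem_kummerOutside_iff W m S b₀).mp hb₀ v hv))
  -- hence `a₁ - a₀' ∈ Ш`, `a₀'` the image of `b₀`, and `m (a₁ - a₀') = a`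
  have hι : torsionH1ToH1 W ((m * m : ℕ) : ℤ) (galoisCohomology.map (inclKD W m m) 1 b₀) =
      torsionH1ToH1 W (m : ℤ) b₀ := by
    rw [map_torsionInclusion_one_apply, torsionH1ToH1_torsionH1OfDvd]
  have hsha : a₁ - torsionH1ToH1 W (m : ℤ) b₀ ∈ W.sha := by
    have h := hsel
    rw [selmerGroup_eq_comap_sha] at h
    change torsionH1ToH1 W ((m * m : ℕ) : ℤ) (b₁ - galoisCohomology.map (inclKD W m m) 1 b₀) ∈ W.sha at h
    rw [FirstCaseData.torsionH1ToH1_sub', hb₁, hι] at h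
    exact h
  have h0 : (m : ℤ) • torsionH1ToH1 W (m : ℤ) b₀ = 0 := torsionH1ToH1_mem_torsionBy W (m : ℤ) b₀
  exact ⟨a₁ - torsionH1ToH1 W (m : ℤ) b₀, hsha, by rw [zsmul_sub, h0, sub_zero, ha₁]⟩

/-- **Milne I Lemma 6.17** (level `m`, first case), as printed: for `a ∈ Ш(E/K)` killed by `m` and
divisible by `m` in `H¹(K, E)` — Milne's `a ∈ Ш'(K, A)` —, `a ∈ m Ш(E/K)` iff `⟨a, a'⟩ = 0` for all
`a' ∈ Ш(E/K)[m]` (first-case pairing `ctFirstCaseFun`; hypotheses `hiso`, `hPT`, `h615` as in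
`exists_mem_sha_smul_eq_of_forall_ctFirstCaseFun_eq_zero`; the easy direction is the tree's
`ctFirstCaseFun_eq_zero_of_eq_smul`). [cite: MilneADT2006, Ch. I §6, Lemma 6.17] -/
theorem exists_mem_sha_smul_eq_iff_forall_ctFirstCaseFun_eq_zero [W.IsElliptic] (S₀ : Finset (Place K))
    (h615 : ∀ S : Finset (Place K), S₀ ⊆ S → ∀ x : LocalClasses W m S,
      (∀ b' ∈ selmerGroup W (m : ℤ), sumPairing W m e hμ hadd₁ hadd₂ hgal inv S x (locS W m S b') = 0) →
        ∃ b₀ ∈ kummerOutside W m S, ∀ v : S,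
          x v - locS W m S b₀ v ∈ W.kummerLocalConditionAt (m : ℤ) (Place.Completion (v : Place K)))
    {a : W.galH1} (ha : a ∈ W.sha) (hma : (m : ℤ) • a = 0) (hdiv : ∃ a₁ : W.galH1, (m : ℤ) • a₁ = a) :
    (∃ a₀ ∈ W.sha, (m : ℤ) • a₀ = a) ↔
      ∀ a' ∈ W.sha, (m : ℤ) • a' = 0 → ctFirstCaseFun W m e hμ hadd₁ hadd₂ hgal inv a a' = 0 := by
  constructor
  · rintro ⟨a₀, ha₀, rfl⟩ a' ha' hma'
    have hm2 : ((m * m : ℕ) : ℤ) • a₀ = 0 := by rw [Nat.cast_mul, mul_zsmul, hma]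
    exact ctFirstCaseFun_eq_zero_of_eq_smul inv hiso hPT ha₀ hm2 ha' hma'
  · intro horth
    obtain ⟨a₁, ha₁⟩ := hdiv
    exact exists_mem_sha_smul_eq_of_forall_ctFirstCaseFun_eq_zero inv hiso hPT S₀ h615 ha hma ha₁ horth

end Pairing

end Literature.NumberTheory.EllipticCurves

end
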